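import Summits.CriticalPhenomena.PercolationContinuityZ3.Theorems.PercNearOneGluingNoHeavyLowerTailThreePartitionLift

/-!
# `NoHeavyLowerTail` (crux stmt-CriticalPhenomena-4575): THREE-PARTITION POSITIVITY WITH ONE PRINCIPAL-FILTER SLOT, every ground set

Support file (lane `prim-ineq-gen-4`, generation 15; `--supports stmt-CriticalPhenomena-4575`).  Pure proofs, no `sorry`, standard axioms;
no definitions (the lift `liftAt` and the pinned-count bookkeeping are in `…ThreePartitionLift`).

THE MATHEMATICS.  `ThreePartitionPositivity` (`…ThreePartitionAD`, OPEN) asks `N(𝒰,𝒱,𝒲) ≥ 0` for all up-sets of a finite power set.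
THEOREM (`threePartN_principal_nonneg`): it holds whenever one family is a PRINCIPAL FILTER `𝒰 = {T | S ⊆ T}`, for every finite
ground set `ι`, every `S ⊆ ι` and all up-sets `𝒱, 𝒲`.  (The case `S = ∅` is the tree's `threePartN_univ_nonneg`, "Kleitman twice".)
PROOF.  Induction on `S`, peeling one element `e ∈ S` at a time with the CONE STEP (`three_mul_threePartN_ge_lift`): if every member of
`𝒰` contains `e`, then `3·N(𝒰,𝒱,𝒲) ≥ N(𝒰ᵉ,𝒱ᵉ,𝒲ᵉ)` where `𝒳ᵉ = {R : Set ι | insert e R ∈ 𝒳} = {T | insert e T ∈ 𝒳}` (an up-set, `e`-free, `⊇ 𝒳`).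
Writing every count of the lifted triple as `3 ×` a count with `e` pinned into the free part `S₂` and moving `e` between parts by explicit
bijections, `3N(𝒰) − N(𝒰ᵉ) = 3·[(D₁ᵉ−D₁) + (D₂ᵉ−D₂) + (D₃ᵉ−D₃) − (Tᵉ−T)]` with `Dᵢᵉ ≥ Dᵢ` termwise and `Tᵉ − T ≤ (D₂ᵉ−D₂) + (D₃ᵉ−D₃)`
by two applications of the fibrewise four-functions inequality `tee ≤ dee` (`tee_le_dee`, whose first family is arbitrary) to the
INCREMENT families `{T ∋ e : T∖e ∈ 𝒱ᵉ∖𝒱}`, `{T ∋ e : T∖e ∈ 𝒲ᵉ∖𝒲}` — the cube form of the lane's "two Kleitman gaps" step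
(memo `run/shared/lean/prim/prim-ineq-gen-4/FINDING-LEVEL2-CUBE-TPP-g15.md`, §3).  Since `(↑(insert e S))ᵉ = ↑S` for `e ∉ S`, induction closes.
HONEST LABEL: a face of `ThreePartitionPositivity` (one principal slot), not the conjecture. [this work]
-/

noncomputable section

open Finset
open scoped Classical

namespace Summit.CriticalPhenomena.PercolationContinuityZ3.Theorems.ThreePartition

variable {ι : Type*} [Fintype ι]

/-! ## The cone step: `3·N(𝒰,𝒱,𝒲) ≥ N(𝒰ᵉ,𝒱ᵉ,𝒲ᵉ)` when every member of `𝒰` contains `e` -/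

section ConeStep

variable (e : ι) {𝒰 𝒱 𝒲 : Set (Set ι)}

/-- `top` of the original triple as a pinned count. [this work] -/
theorem top_eq_pin (h𝒰e : ∀ T ∈ 𝒰, e ∈ T) :
    top (𝒰 ∩ 𝒱 ∩ 𝒲) = tri (fun _ S₂ S₃ => e ∈ S₂ ∧ S₃ ∈ {R : Set ι | insert e R ∈ 𝒰 ∩ 𝒱 ∩ 𝒲}) := by
  unfold top
  rw [show tri (fun _ _ S₃ => S₃ ∈ 𝒰 ∩ 𝒱 ∩ 𝒲) = tri (fun S₁ S₂ S₃ => e ∈ S₃ ∧ (fun (_ _ S₃ : Set ι) => S₃ ∈ 𝒰 ∩ 𝒱 ∩ 𝒲) S₁ S₂ S₃) from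
    tri_congr fun S₁ S₂ _ => ⟨fun h => ⟨h𝒰e _ h.1.1, h⟩, fun h => h.2⟩]
  rw [tri_move32]
  rfl

/-- `top` of the lifted triple is three times the pinned count. [this work] -/
theorem top_lift_eq_three_mul :
    top ({R : Set ι | insert e R ∈ 𝒰} ∩ {R : Set ι | insert e R ∈ 𝒱} ∩ {R : Set ι | insert e R ∈ 𝒲}) = 3 * tri (fun _ S₂ S₃ => e ∈ S₂ ∧ S₃ ∈ {R : Set ι | insert e R ∈ 𝒰 ∩ 𝒱 ∩ 𝒲}) := by
  unfold top
  rw [tri_eq_three_mul_pin e]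
  · rfl
  · intro _ _ _; exact Iff.rfl
  · intro _ _ S₃
    show insert e S₃ ∈ {R : Set ι | insert e R ∈ 𝒰 ∩ 𝒱 ∩ 𝒲} ↔ S₃ ∈ {R : Set ι | insert e R ∈ 𝒰 ∩ 𝒱 ∩ 𝒲}
    exact insert_mem_liftAt_iff e _ S₃

/-- `dee(𝒰, 𝒱∩𝒲)` is at most the pinned lifted count. [this work] -/
theorem dee_one_le_pin (h𝒰e : ∀ T ∈ 𝒰, e ∈ T) (h𝒱 : IsUpperSet 𝒱) (h𝒲 : IsUpperSet 𝒲) :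
    dee 𝒰 (𝒱 ∩ 𝒲) ≤ tri (fun S₁ S₂ S₃ => e ∈ S₂ ∧ (S₁ ∈ {R : Set ι | insert e R ∈ 𝒰} ∧ S₃ ∈ {R : Set ι | insert e R ∈ 𝒱} ∩ {R : Set ι | insert e R ∈ 𝒲})) := by
  unfold dee
  rw [show tri (fun S₁ _ S₃ => S₁ ∈ 𝒰 ∧ S₃ ∈ 𝒱 ∩ 𝒲) = tri (fun S₁ S₂ S₃ => e ∈ S₁ ∧ (fun (S₁ _ S₃ : Set ι) => S₁ ∈ 𝒰 ∧ S₃ ∈ 𝒱 ∩ 𝒲) S₁ S₂ S₃) from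
    tri_congr fun S₁ S₂ _ => ⟨fun h => ⟨h𝒰e _ h.1, h⟩, fun h => h.2⟩]
  rw [tri_move12]
  refine tri_mono fun S₁ S₂ _ h => ⟨h.1, h.2.1, ?_⟩
  exact mem_liftAt_of_mem e (h𝒱.inter h𝒲) h.2.2

/-- `dee` of the lifted triple (first slot) is three times the pinned count. [this work] -/
theorem dee_one_lift_eq_three_mul :
    dee ({R : Set ι | insert e R ∈ 𝒰}) ({R : Set ι | insert e R ∈ 𝒱} ∩ {R : Set ι | insert e R ∈ 𝒲}) = 3 * tri (fun S₁ S₂ S₃ => e ∈ S₂ ∧ (S₁ ∈ {R : Set ι | insert e R ∈ 𝒰} ∧ S₃ ∈ {R : Set ι | insert e R ∈ 𝒱} ∩ {R : Set ι | insert e R ∈ 𝒲})) := by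
  unfold dee
  rw [tri_eq_three_mul_pin e]
  · intro S₁ _ S₃
    show insert e S₁ ∈ {R : Set ι | insert e R ∈ 𝒰} ∧ S₃ ∈ _ ↔ S₁ ∈ {R : Set ι | insert e R ∈ 𝒰} ∧ S₃ ∈ _
    rw [insert_mem_liftAt_iff]
  · intro S₁ _ S₃
    show S₁ ∈ {R : Set ι | insert e R ∈ 𝒰} ∧ insert e S₃ ∈ {R : Set ι | insert e R ∈ 𝒱} ∩ {R : Set ι | insert e R ∈ 𝒲} ↔ S₁ ∈ {R : Set ι | insert e R ∈ 𝒰} ∧ S₃ ∈ {R : Set ι | insert e R ∈ 𝒱} ∩ {R : Set ι | insert e R ∈ 𝒲}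
    rw [← liftAt_inter, insert_mem_liftAt_iff]

/-- `dee(𝒱, 𝒰∩𝒲)` as a pinned count (move `e` out of part 3). [this work] -/
theorem dee_two_eq_pin (h𝒰e : ∀ T ∈ 𝒰, e ∈ T) :
    dee 𝒱 (𝒰 ∩ 𝒲) = tri (fun S₁ S₂ S₃ => e ∈ S₂ ∧ (S₁ ∈ 𝒱 ∧ S₃ ∈ {R : Set ι | insert e R ∈ 𝒰 ∩ 𝒲})) := by
  unfold dee
  rw [show tri (fun S₁ _ S₃ => S₁ ∈ 𝒱 ∧ S₃ ∈ 𝒰 ∩ 𝒲) = tri (fun S₁ S₂ S₃ => e ∈ S₃ ∧ (fun (S₁ _ S₃ : Set ι) => S₁ ∈ 𝒱 ∧ S₃ ∈ 𝒰 ∩ 𝒲) S₁ S₂ S₃) from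
    tri_congr fun S₁ S₂ _ => ⟨fun h => ⟨h𝒰e _ h.2.1, h⟩, fun h => h.2⟩]
  rw [tri_move32]
  rfl

/-- `dee` of the lifted triple (second slot) is three times the pinned count. [this work] -/
theorem dee_two_lift_eq_three_mul :
    dee ({R : Set ι | insert e R ∈ 𝒱}) ({R : Set ι | insert e R ∈ 𝒰} ∩ {R : Set ι | insert e R ∈ 𝒲}) = 3 * tri (fun S₁ S₂ S₃ => e ∈ S₂ ∧ (S₁ ∈ {R : Set ι | insert e R ∈ 𝒱} ∧ S₃ ∈ {R : Set ι | insert e R ∈ 𝒰} ∩ {R : Set ι | insert e R ∈ 𝒲})) := by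
  unfold dee
  rw [tri_eq_three_mul_pin e]
  · intro S₁ _ S₃
    show insert e S₁ ∈ {R : Set ι | insert e R ∈ 𝒱} ∧ S₃ ∈ _ ↔ S₁ ∈ {R : Set ι | insert e R ∈ 𝒱} ∧ S₃ ∈ _
    rw [insert_mem_liftAt_iff]
  · intro S₁ _ S₃
    show S₁ ∈ {R : Set ι | insert e R ∈ 𝒱} ∧ insert e S₃ ∈ {R : Set ι | insert e R ∈ 𝒰} ∩ {R : Set ι | insert e R ∈ 𝒲} ↔ S₁ ∈ {R : Set ι | insert e R ∈ 𝒱} ∧ S₃ ∈ {R : Set ι | insert e R ∈ 𝒰} ∩ {R : Set ι | insert e R ∈ 𝒲}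
    rw [← liftAt_inter, insert_mem_liftAt_iff]

/-- The increment of the second slot pays: `d₂ + g₂ ≤ d₂ᵉ`. [this work] -/
theorem dee_two_add_gain_le (h𝒱 : IsUpperSet 𝒱) :
    tri (fun S₁ S₂ S₃ => e ∈ S₂ ∧ (S₁ ∈ 𝒱 ∧ S₃ ∈ {R : Set ι | insert e R ∈ 𝒰 ∩ 𝒲}))
      + tri (fun S₁ S₂ S₃ => e ∈ S₂ ∧ ((S₁ ∈ {R : Set ι | insert e R ∈ 𝒱} ∧ S₁ ∉ 𝒱) ∧ S₃ ∈ {R : Set ι | insert e R ∈ 𝒰} ∩ {R : Set ι | insert e R ∈ 𝒲}))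
      ≤ tri (fun S₁ S₂ S₃ => e ∈ S₂ ∧ (S₁ ∈ {R : Set ι | insert e R ∈ 𝒱} ∧ S₃ ∈ {R : Set ι | insert e R ∈ 𝒰} ∩ {R : Set ι | insert e R ∈ 𝒲})) := by
  refine tri_add_le (fun S₁ S₂ S₃ h => ⟨h.1, mem_liftAt_of_mem e h𝒱 h.2.1, ?_⟩) (fun S₁ S₂ S₃ h => ⟨h.1, h.2.1.1, h.2.2⟩)
    (fun S₁ S₂ S₃ h h' => h'.2.1.2 h.2.1)
  rw [← liftAt_inter]; exact h.2.2

/-- `tee(𝒰,𝒱,𝒲)` as a pinned count (move `e` out of part 1). [this work] -/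
theorem tee_eq_pin (h𝒰e : ∀ T ∈ 𝒰, e ∈ T) :
    tee 𝒰 𝒱 𝒲 = tri (fun S₁ S₂ S₃ => e ∈ S₂ ∧ (S₁ ∈ {R : Set ι | insert e R ∈ 𝒰} ∧ S₂ \ {e} ∈ 𝒱 ∧ S₃ ∈ 𝒲)) := by
  unfold tee
  rw [show tri (fun S₁ S₂ S₃ => S₁ ∈ 𝒰 ∧ S₂ ∈ 𝒱 ∧ S₃ ∈ 𝒲) = tri (fun S₁ S₂ S₃ => e ∈ S₁ ∧ (fun (S₁ S₂ S₃ : Set ι) => S₁ ∈ 𝒰 ∧ S₂ ∈ 𝒱 ∧ S₃ ∈ 𝒲) S₁ S₂ S₃) from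
    tri_congr fun S₁ S₂ _ => ⟨fun h => ⟨h𝒰e _ h.1, h⟩, fun h => h.2⟩]
  rw [tri_move12]
  rfl

/-- `tee` of the lifted triple is three times a pinned count (with `S₂ ∈ 𝒱` in place of `S₂ ∈ 𝒱ᵉ`). [this work] -/
theorem tee_lift_eq_three_mul :
    tee ({R : Set ι | insert e R ∈ 𝒰}) ({R : Set ι | insert e R ∈ 𝒱}) ({R : Set ι | insert e R ∈ 𝒲}) = 3 * tri (fun S₁ S₂ S₃ => e ∈ S₂ ∧ (S₁ ∈ {R : Set ι | insert e R ∈ 𝒰} ∧ S₂ ∈ 𝒱 ∧ S₃ ∈ {R : Set ι | insert e R ∈ 𝒲})) := by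
  unfold tee
  rw [tri_eq_three_mul_pin e]
  · congr 1
    refine tri_congr fun S₁ S₂ _ => ?_
    constructor
    · rintro ⟨he, h1, h2, h3⟩; exact ⟨he, h1, (mem_liftAt_iff_of_mem 𝒱 he).1 h2, h3⟩
    · rintro ⟨he, h1, h2, h3⟩; exact ⟨he, h1, (mem_liftAt_iff_of_mem 𝒱 he).2 h2, h3⟩
  · intro S₁ S₂ S₃
    show insert e S₁ ∈ {R : Set ι | insert e R ∈ 𝒰} ∧ S₂ \ {e} ∈ {R : Set ι | insert e R ∈ 𝒱} ∧ S₃ ∈ {R : Set ι | insert e R ∈ 𝒲} ↔ S₁ ∈ {R : Set ι | insert e R ∈ 𝒰} ∧ S₂ ∈ {R : Set ι | insert e R ∈ 𝒱} ∧ S₃ ∈ {R : Set ι | insert e R ∈ 𝒲}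
    rw [insert_mem_liftAt_iff, diff_mem_liftAt_iff]
  · intro S₁ S₂ S₃
    show S₁ ∈ {R : Set ι | insert e R ∈ 𝒰} ∧ S₂ \ {e} ∈ {R : Set ι | insert e R ∈ 𝒱} ∧ insert e S₃ ∈ {R : Set ι | insert e R ∈ 𝒲} ↔ S₁ ∈ {R : Set ι | insert e R ∈ 𝒰} ∧ S₂ ∈ {R : Set ι | insert e R ∈ 𝒱} ∧ S₃ ∈ {R : Set ι | insert e R ∈ 𝒲}
    rw [insert_mem_liftAt_iff, diff_mem_liftAt_iff]

/-- The pinned lifted `tee` exceeds the pinned original `tee` by at most the two increment counts `X + Y`. [this work] -/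
theorem tee_pin_le_add :
    tri (fun S₁ S₂ S₃ => e ∈ S₂ ∧ (S₁ ∈ {R : Set ι | insert e R ∈ 𝒰} ∧ S₂ ∈ 𝒱 ∧ S₃ ∈ {R : Set ι | insert e R ∈ 𝒲}))
      ≤ tri (fun S₁ S₂ S₃ => e ∈ S₂ ∧ (S₁ ∈ {R : Set ι | insert e R ∈ 𝒰} ∧ S₂ \ {e} ∈ 𝒱 ∧ S₃ ∈ 𝒲))
        + tri (fun S₁ S₂ S₃ => e ∈ S₂ ∧ (S₁ ∈ {R : Set ι | insert e R ∈ 𝒰} ∧ (S₂ \ {e} ∈ {R : Set ι | insert e R ∈ 𝒱} ∧ S₂ \ {e} ∉ 𝒱) ∧ S₃ ∈ {R : Set ι | insert e R ∈ 𝒲}))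
        + tri (fun S₁ S₂ S₃ => e ∈ S₂ ∧ (S₁ ∈ {R : Set ι | insert e R ∈ 𝒰} ∧ S₂ \ {e} ∈ 𝒱 ∧ (S₃ ∈ {R : Set ι | insert e R ∈ 𝒲} ∧ S₃ ∉ 𝒲))) := by
  refine tri_le_add₃ fun S₁ S₂ S₃ h => ?_
  obtain ⟨he, h1, h2, h3⟩ := h
  by_cases hV : S₂ \ {e} ∈ 𝒱
  · by_cases hW : S₃ ∈ 𝒲
    · exact Or.inl ⟨he, h1, hV, hW⟩
    · exact Or.inr (Or.inr ⟨he, h1, hV, h3, hW⟩)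
  · refine Or.inr (Or.inl ⟨he, h1, ⟨?_, hV⟩, h3⟩)
    rw [diff_mem_liftAt_iff, mem_liftAt_iff_of_mem 𝒱 he]; exact h2


/-- The second-slot increment pays for `X`: a fibrewise four-functions step (`tee ≤ dee`) on the increment family
`{T ∋ e : T ∖ e ∈ 𝒱ᵉ ∖ 𝒱}`. [this work] -/
theorem incr_two_le (h𝒰 : IsUpperSet 𝒰) (h𝒲 : IsUpperSet 𝒲) :
    tri (fun S₁ S₂ S₃ => e ∈ S₂ ∧ (S₁ ∈ {R : Set ι | insert e R ∈ 𝒰} ∧ (S₂ \ {e} ∈ {R : Set ι | insert e R ∈ 𝒱} ∧ S₂ \ {e} ∉ 𝒱) ∧ S₃ ∈ {R : Set ι | insert e R ∈ 𝒲}))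
      ≤ tri (fun S₁ S₂ S₃ => e ∈ S₂ ∧ ((S₁ ∈ {R : Set ι | insert e R ∈ 𝒱} ∧ S₁ ∉ 𝒱) ∧ S₃ ∈ {R : Set ι | insert e R ∈ 𝒰} ∩ {R : Set ι | insert e R ∈ 𝒲})) := by
  set 𝒟 : Set (Set ι) := {T | e ∈ T ∧ (T \ {e} ∈ {R : Set ι | insert e R ∈ 𝒱} ∧ T \ {e} ∉ 𝒱)} with h𝒟
  have step1 : tri (fun S₁ S₂ S₃ => e ∈ S₂ ∧ (S₁ ∈ {R : Set ι | insert e R ∈ 𝒰} ∧ (S₂ \ {e} ∈ {R : Set ι | insert e R ∈ 𝒱} ∧ S₂ \ {e} ∉ 𝒱) ∧ S₃ ∈ {R : Set ι | insert e R ∈ 𝒲}))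
      ≤ tee ({R : Set ι | insert e R ∈ 𝒰}) 𝒟 ({R : Set ι | insert e R ∈ 𝒲}) := by
    unfold tee
    exact tri_mono fun S₁ S₂ _ h => ⟨h.2.1, ⟨h.1, h.2.2.1⟩, h.2.2.2⟩
  have step2 : tee ({R : Set ι | insert e R ∈ 𝒰}) 𝒟 ({R : Set ι | insert e R ∈ 𝒲}) = tee 𝒟 ({R : Set ι | insert e R ∈ 𝒰}) ({R : Set ι | insert e R ∈ 𝒲}) := tee_swap12 _ _ _
  have step3 : tee 𝒟 ({R : Set ι | insert e R ∈ 𝒰}) ({R : Set ι | insert e R ∈ 𝒲}) ≤ dee 𝒟 ({R : Set ι | insert e R ∈ 𝒰} ∩ {R : Set ι | insert e R ∈ 𝒲}) :=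
    tee_le_dee 𝒟 (isUpperSet_liftAt e h𝒰) (isUpperSet_liftAt e h𝒲)
  have step4 : dee 𝒟 ({R : Set ι | insert e R ∈ 𝒰} ∩ {R : Set ι | insert e R ∈ 𝒲})
      = tri (fun S₁ S₂ S₃ => e ∈ S₂ ∧ ((S₁ ∈ {R : Set ι | insert e R ∈ 𝒱} ∧ S₁ ∉ 𝒱) ∧ S₃ ∈ {R : Set ι | insert e R ∈ 𝒰} ∩ {R : Set ι | insert e R ∈ 𝒲})) := by
    unfold dee
    rw [show tri (fun S₁ _ S₃ => S₁ ∈ 𝒟 ∧ S₃ ∈ {R : Set ι | insert e R ∈ 𝒰} ∩ {R : Set ι | insert e R ∈ 𝒲})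
        = tri (fun S₁ S₂ S₃ => e ∈ S₁ ∧ (fun (S₁ _ S₃ : Set ι) => (S₁ \ {e} ∈ {R : Set ι | insert e R ∈ 𝒱} ∧ S₁ \ {e} ∉ 𝒱) ∧ S₃ ∈ {R : Set ι | insert e R ∈ 𝒰} ∩ {R : Set ι | insert e R ∈ 𝒲}) S₁ S₂ S₃) from
      tri_congr fun S₁ S₂ _ => by rw [h𝒟]; simp only [Set.mem_setOf_eq]; tauto]
    rw [tri_move12]
    refine tri_congr fun S₁ S₂ hd => ?_
    constructor
    · rintro ⟨he, hA, hC⟩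
      have he1 : e ∉ S₁ := fun h => Set.disjoint_left.1 hd h he
      rw [insert_sdiff_singleton_of_notMem he1] at hA
      exact ⟨he, hA, hC⟩
    · rintro ⟨he, hA, hC⟩
      have he1 : e ∉ S₁ := fun h => Set.disjoint_left.1 hd h he
      refine ⟨he, ?_, hC⟩
      rw [insert_sdiff_singleton_of_notMem he1]
      exact hA
  calc _ ≤ _ := step1
    _ = _ := step2
    _ ≤ _ := step3
    _ = _ := step4

/-- The third-slot increment pays for `Y` (same mechanism, the increment family sits in part 3). [this work] -/
theorem incr_three_le (h𝒰 : IsUpperSet 𝒰) (h𝒱 : IsUpperSet 𝒱) :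
    tri (fun S₁ S₂ S₃ => e ∈ S₂ ∧ (S₁ ∈ {R : Set ι | insert e R ∈ 𝒰} ∧ S₂ \ {e} ∈ 𝒱 ∧ (S₃ ∈ {R : Set ι | insert e R ∈ 𝒲} ∧ S₃ ∉ 𝒲)))
      ≤ tri (fun S₁ S₂ S₃ => e ∈ S₂ ∧ ((S₁ ∈ {R : Set ι | insert e R ∈ 𝒲} ∧ S₁ ∉ 𝒲) ∧ S₃ ∈ {R : Set ι | insert e R ∈ 𝒰} ∩ {R : Set ι | insert e R ∈ 𝒱})) := by
  set 𝒟 : Set (Set ι) := {T | e ∈ T ∧ (T \ {e} ∈ {R : Set ι | insert e R ∈ 𝒲} ∧ T \ {e} ∉ 𝒲)} with h𝒟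
  have step0 : tri (fun S₁ S₂ S₃ => e ∈ S₂ ∧ (S₁ ∈ {R : Set ι | insert e R ∈ 𝒰} ∧ S₂ \ {e} ∈ 𝒱 ∧ (S₃ ∈ {R : Set ι | insert e R ∈ 𝒲} ∧ S₃ ∉ 𝒲)))
      = tri (fun S₁ S₂ S₃ => e ∈ S₃ ∧ (fun (S₁ S₂ S₃ : Set ι) => S₁ ∈ {R : Set ι | insert e R ∈ 𝒰} ∧ S₂ ∈ 𝒱 ∧ (S₃ ∈ {R : Set ι | insert e R ∈ 𝒲} ∧ S₃ \ {e} ∉ 𝒲)) S₁ S₂ S₃) := by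
    rw [tri_move32]
    refine tri_congr fun S₁ S₂ hd => ?_
    constructor
    · rintro ⟨he, h1, h2, h3, h4⟩
      have he3 : e ∉ (S₁ ∪ S₂)ᶜ := fun h => h (Or.inr he)
      refine ⟨he, h1, h2, ?_, ?_⟩
      · rw [insert_mem_liftAt_iff]; exact h3
      · rw [insert_sdiff_singleton_of_notMem he3]; exact h4
    · rintro ⟨he, h1, h2, h3, h4⟩
      have he3 : e ∉ (S₁ ∪ S₂)ᶜ := fun h => h (Or.inr he)
      refine ⟨he, h1, h2, ?_, ?_⟩
      · rw [insert_mem_liftAt_iff] at h3; exact h3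
      · rw [insert_sdiff_singleton_of_notMem he3] at h4; exact h4
  have step1 : tri (fun S₁ S₂ S₃ => e ∈ S₃ ∧ (fun (S₁ S₂ S₃ : Set ι) => S₁ ∈ {R : Set ι | insert e R ∈ 𝒰} ∧ S₂ ∈ 𝒱 ∧ (S₃ ∈ {R : Set ι | insert e R ∈ 𝒲} ∧ S₃ \ {e} ∉ 𝒲)) S₁ S₂ S₃)
      ≤ tee ({R : Set ι | insert e R ∈ 𝒰}) ({R : Set ι | insert e R ∈ 𝒱}) 𝒟 := by
    unfold tee
    refine tri_mono fun S₁ S₂ _ h => ⟨h.2.1, mem_liftAt_of_mem e h𝒱 h.2.2.1, ⟨h.1, ?_, h.2.2.2.2⟩⟩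
    rw [diff_mem_liftAt_iff]; exact h.2.2.2.1
  have step2 : tee ({R : Set ι | insert e R ∈ 𝒰}) ({R : Set ι | insert e R ∈ 𝒱}) 𝒟 = tee 𝒟 ({R : Set ι | insert e R ∈ 𝒱}) ({R : Set ι | insert e R ∈ 𝒰}) := tee_swap13 _ _ _
  have step3 : tee 𝒟 ({R : Set ι | insert e R ∈ 𝒱}) ({R : Set ι | insert e R ∈ 𝒰}) ≤ dee 𝒟 ({R : Set ι | insert e R ∈ 𝒱} ∩ {R : Set ι | insert e R ∈ 𝒰}) :=
    tee_le_dee 𝒟 (isUpperSet_liftAt e h𝒱) (isUpperSet_liftAt e h𝒰)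
  have step4 : dee 𝒟 ({R : Set ι | insert e R ∈ 𝒱} ∩ {R : Set ι | insert e R ∈ 𝒰})
      = tri (fun S₁ S₂ S₃ => e ∈ S₂ ∧ ((S₁ ∈ {R : Set ι | insert e R ∈ 𝒲} ∧ S₁ ∉ 𝒲) ∧ S₃ ∈ {R : Set ι | insert e R ∈ 𝒰} ∩ {R : Set ι | insert e R ∈ 𝒱})) := by
    unfold dee
    rw [show tri (fun S₁ _ S₃ => S₁ ∈ 𝒟 ∧ S₃ ∈ {R : Set ι | insert e R ∈ 𝒱} ∩ {R : Set ι | insert e R ∈ 𝒰})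
        = tri (fun S₁ S₂ S₃ => e ∈ S₁ ∧ (fun (S₁ _ S₃ : Set ι) => (S₁ \ {e} ∈ {R : Set ι | insert e R ∈ 𝒲} ∧ S₁ \ {e} ∉ 𝒲) ∧ S₃ ∈ {R : Set ι | insert e R ∈ 𝒰} ∩ {R : Set ι | insert e R ∈ 𝒱}) S₁ S₂ S₃) from
      tri_congr fun S₁ S₂ _ => by
        rw [h𝒟, Set.inter_comm]; simp only [Set.mem_setOf_eq]; tauto]
    rw [tri_move12]
    refine tri_congr fun S₁ S₂ hd => ?_
    constructor
    · rintro ⟨he, hA, hC⟩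
      have he1 : e ∉ S₁ := fun h => Set.disjoint_left.1 hd h he
      rw [insert_sdiff_singleton_of_notMem he1] at hA
      exact ⟨he, hA, hC⟩
    · rintro ⟨he, hA, hC⟩
      have he1 : e ∉ S₁ := fun h => Set.disjoint_left.1 hd h he
      refine ⟨he, ?_, hC⟩
      rw [insert_sdiff_singleton_of_notMem he1]
      exact hA
  calc _ = _ := step0
    _ ≤ _ := step1
    _ = _ := step2
    _ ≤ _ := step3
    _ = _ := step4

/-- **THE CONE STEP.**  If every member of the up-set `𝒰` contains `e`, then `N(𝒰ᵉ,𝒱ᵉ,𝒲ᵉ) ≤ 3·N(𝒰,𝒱,𝒲)`. [this work] -/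
theorem threePartN_lift_le_three_mul (h𝒰 : IsUpperSet 𝒰) (h𝒱 : IsUpperSet 𝒱) (h𝒲 : IsUpperSet 𝒲)
    (h𝒰e : ∀ T ∈ 𝒰, e ∈ T) :
    threePartN ({R : Set ι | insert e R ∈ 𝒰}) ({R : Set ι | insert e R ∈ 𝒱}) ({R : Set ι | insert e R ∈ 𝒲}) ≤ 3 * threePartN 𝒰 𝒱 𝒲 := by
  have htop := top_eq_pin e (𝒱 := 𝒱) (𝒲 := 𝒲) h𝒰e
  have htop' := top_lift_eq_three_mul e (𝒰 := 𝒰) (𝒱 := 𝒱) (𝒲 := 𝒲)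
  have hd1 := dee_one_le_pin e h𝒰e h𝒱 h𝒲
  have hd1' := dee_one_lift_eq_three_mul e (𝒰 := 𝒰) (𝒱 := 𝒱) (𝒲 := 𝒲)
  have hd2 := dee_two_eq_pin e (𝒱 := 𝒱) (𝒲 := 𝒲) h𝒰e
  have hd2' := dee_two_lift_eq_three_mul e (𝒰 := 𝒰) (𝒱 := 𝒱) (𝒲 := 𝒲)
  have hg2 := dee_two_add_gain_le e (𝒰 := 𝒰) (𝒲 := 𝒲) h𝒱
  have hd3 := dee_two_eq_pin e (𝒱 := 𝒲) (𝒲 := 𝒱) h𝒰e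
  have hd3' := dee_two_lift_eq_three_mul e (𝒰 := 𝒰) (𝒱 := 𝒲) (𝒲 := 𝒱)
  have hg3 := dee_two_add_gain_le e (𝒰 := 𝒰) (𝒲 := 𝒱) h𝒲
  have ht := tee_eq_pin e (𝒱 := 𝒱) (𝒲 := 𝒲) h𝒰e
  have ht' := tee_lift_eq_three_mul e (𝒰 := 𝒰) (𝒱 := 𝒱) (𝒲 := 𝒲)
  have hsplit := tee_pin_le_add e (𝒰 := 𝒰) (𝒱 := 𝒱) (𝒲 := 𝒲)
  have hX := incr_two_le e (𝒱 := 𝒱) h𝒰 h𝒲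
  have hY := incr_three_le e (𝒲 := 𝒲) h𝒰 h𝒱
  unfold threePartN
  rw [htop, htop', hd1', hd2, hd2', hd3, hd3', ht, ht']
  push_cast
  omega

end ConeStep

/-! ## Induction over the generating set: one principal slot -/

/-- Principal filters of finsets: `N({T | S ⊆ T}, 𝒱, 𝒲) ≥ 0`. [this work] -/
theorem threePartN_principal_finset_nonneg (S : Finset ι) :
    ∀ {𝒱 𝒲 : Set (Set ι)}, IsUpperSet 𝒱 → IsUpperSet 𝒲 → 0 ≤ threePartN {T : Set ι | (S : Set ι) ⊆ T} 𝒱 𝒲 := by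
  induction S using Finset.induction_on with
  | empty =>
    intro 𝒱 𝒲 h𝒱 h𝒲
    have h : {T : Set ι | ((∅ : Finset ι) : Set ι) ⊆ T} = (Set.univ : Set (Set ι)) := by
      ext T; simp
    rw [h]
    exact threePartN_univ_nonneg h𝒱 h𝒲
  | @insert e S he ih =>
    intro 𝒱 𝒲 h𝒱 h𝒲
    have hU : IsUpperSet {T : Set ι | ((insert e S : Finset ι) : Set ι) ⊆ T} :=
      fun A B hAB hA => Set.Subset.trans hA hAB
    have hUe : ∀ T ∈ {T : Set ι | ((insert e S : Finset ι) : Set ι) ⊆ T}, e ∈ T :=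
      fun T hT => hT (by simp)
    have h3 := threePartN_lift_le_three_mul e hU h𝒱 h𝒲 hUe
    rw [liftAt_principal_insert e S he] at h3
    have h0 := ih (isUpperSet_liftAt e h𝒱) (isUpperSet_liftAt e h𝒲)
    linarith

/-- **THREE-PARTITION POSITIVITY WITH ONE PRINCIPAL SLOT** (every finite ground set): for every `S ⊆ ι` and all up-sets
`𝒱, 𝒲`, `0 ≤ N({T | S ⊆ T}, 𝒱, 𝒲)` — the case of `ThreePartitionPositivity` in which one family is a principal filter. [this work] -/
theorem threePartN_principal_nonneg (S : Set ι) {𝒱 𝒲 : Set (Set ι)} (h𝒱 : IsUpperSet 𝒱) (h𝒲 : IsUpperSet 𝒲) :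
    0 ≤ threePartN {T : Set ι | S ⊆ T} 𝒱 𝒲 := by
  have h := threePartN_principal_finset_nonneg S.toFinite.toFinset h𝒱 h𝒲
  simp only [Set.Finite.coe_toFinset] at h
  exact h


end Summit.CriticalPhenomena.PercolationContinuityZ3.Theorems.ThreePartition
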